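import Mathlib
import Summits.CriticalPhenomena.Ising3DConformalLimit.Theorems.GaussianScaleMixtureCriticalTwoPointGSMJsNoAtom
import Literature.Probability.LatticeModels.CriticalTwoPointBounds
import Literature.Probability.LatticeModels.CriticalTwoPointLawDimension

/-!
# Crux `CriticalTwoPointGSM` (stmt-CriticalPhenomena-8365), line `Sketch` (canonical-lift spine,
seat c1) — stubs `js_noAtomOne` (no spectral mass at `λ = 1`) and `rpInterpolation_tendsto_zero`
(the RP interpolation vanishes at infinite axial separation)

Write a site of `ℤ³` as `Fin.cons n z` (`n ∈ ℤ` the reflection-positive axis, `z ∈ ℤ²` transverse)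
and a point of the spectral side as `p : Fin 3 → ℝ`, `p 0 = λ`, `(p 1, p 2) = k`. A *joint spectral
measure* of the critical two-point function `G = ⟨σ₀σ_x⟩⁺_{β_c}` of the nearest-neighbour Ising model
on `ℤ³` is a probability measure `ρ` on `ℝ³` carried by the box `[0,1]×[-π,π]²` with
`G(n, z) = ∫ λ^{|n|} cos(k·z) dρ` for all `n ∈ ℤ`, `z ∈ ℤ²`.

**Theorem `js_noAtomOne`.** Every joint spectral measure has `ρ {1 ≤ λ} = 0` (no long-range order
at `β_c`).

*Proof.* At `z = 0` the representation reads `G(n e₀) = ∫ λⁿ dρ` (`axisMoment_eq`). Since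
`λ ≥ 0` `ρ`-a.e., `λⁿ ≥ 𝟙{λ ≥ 1}` `ρ`-a.e., so `ρ{1 ≤ λ} ≤ G(n e₀)` for every `n`; and
`G(n e₀) → 0` (`criticalTwoPoint_tendsto_zero_cofinite`, from the infrared upper bound
`G(x) ≤ C‖x‖⁻¹` of `criticalTwoPoint_bounds_holds`). Hence `ρ{1 ≤ λ} = 0`.

**Theorem `rpInterpolation_tendsto_zero`.** If moreover `ρ {1 ≤ λ} = 0` then for every `z ∈ ℤ²`
the RP interpolation `F(t, z) = ∫ λ^t cos(k·z) dρ` tends to `0` as `t → ∞`.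

*Proof.* `ρ`-a.e. `0 ≤ λ < 1`, so `λ^t cos(k·z) → 0` pointwise a.e. as `t → ∞`
(`tendsto_rpow_atTop_of_base_lt_one`), with `|λ^t cos(k·z)| ≤ 1` for `t ≥ 0`; dominated
convergence (`tendsto_integral_filter_of_dominated_convergence`) gives `F(t, z) → ∫ 0 = 0`.
-/

namespace Summit.CriticalPhenomena.Ising3DConformalLimit.Theorems

open MeasureTheory Filter Topology
open Literature.Probability.LatticeModels
open scoped BigOperators

noncomputable section

namespace CriticalTwoPointGSMJs.NoAtomOne

/-- A probability measure carried by the box `[0,1]×[-π,π]²` has `0 ≤ λ ≤ 1` almost everywhere. -/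
theorem ae_mem_Icc_of_box (ρ : Measure (Fin 3 → ℝ))
    (hsupp : ρ {p | 0 ≤ p 0 ∧ p 0 ≤ 1 ∧ ∀ j : Fin 2, -Real.pi ≤ p j.succ ∧ p j.succ ≤ Real.pi}ᶜ = 0) :
    ∀ᵐ p ∂ρ, 0 ≤ p 0 ∧ p 0 ≤ 1 := by
  have h : ∀ᵐ p ∂ρ, 0 ≤ p 0 ∧ p 0 ≤ 1 ∧ ∀ j : Fin 2, -Real.pi ≤ p j.succ ∧ p j.succ ≤ Real.pi :=
    mem_ae_iff.2 hsupp
  filter_upwards [h] with p hp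
  exact ⟨hp.1, hp.2.1⟩

/-- With no mass on `{1 ≤ λ}` in addition, `0 ≤ λ < 1` almost everywhere. -/
theorem ae_mem_Ico_of_box (ρ : Measure (Fin 3 → ℝ))
    (hsupp : ρ {p | 0 ≤ p 0 ∧ p 0 ≤ 1 ∧ ∀ j : Fin 2, -Real.pi ≤ p j.succ ∧ p j.succ ≤ Real.pi}ᶜ = 0)
    (hone : ρ {p | 1 ≤ p 0} = 0) :
    ∀ᵐ p ∂ρ, 0 ≤ p 0 ∧ p 0 < 1 := by
  have h1 : ∀ᵐ p ∂ρ, p ∉ {p : Fin 3 → ℝ | 1 ≤ p 0} := measure_eq_zero_iff_ae_notMem.1 hone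
  filter_upwards [ae_mem_Icc_of_box ρ hsupp, h1] with p hp hp1
  exact ⟨hp.1, not_le.1 hp1⟩

/-- For a probability measure carried by the box, the mass of `{1 ≤ λ}` is at most every axis
moment `∫ λⁿ dρ` (on that set `λⁿ ≥ 1`, elsewhere `λⁿ ≥ 0` a.e.). -/
theorem measureReal_one_le_le_axisMoment (ρ : Measure (Fin 3 → ℝ)) [IsProbabilityMeasure ρ]
    (hsupp : ρ {p | 0 ≤ p 0 ∧ p 0 ≤ 1 ∧ ∀ j : Fin 2, -Real.pi ≤ p j.succ ∧ p j.succ ≤ Real.pi}ᶜ = 0)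
    (n : ℕ) : ρ.real {p | 1 ≤ p 0} ≤ ∫ p, (p 0) ^ n ∂ρ := by
  have hS : MeasurableSet {p : Fin 3 → ℝ | 1 ≤ p 0} :=
    measurableSet_le measurable_const (measurable_pi_apply 0)
  rw [← integral_indicator_one hS]
  have hae := ae_mem_Icc_of_box ρ hsupp
  refine integral_mono_ae ((integrable_const (1 : ℝ)).indicator hS) ?_ ?_
  · -- `λⁿ` is bounded by `1` a.e., hence integrable against the probability measure `ρ`
    refine Integrable.mono' (integrable_const (1 : ℝ))
      ((measurable_pi_apply 0).pow_const n).aestronglyMeasurable ?_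
    filter_upwards [hae] with p hp
    rw [Real.norm_eq_abs, abs_of_nonneg (pow_nonneg hp.1 n)]
    exact pow_le_one₀ hp.1 hp.2
  · filter_upwards [hae] with p hp
    by_cases h1 : 1 ≤ p 0
    · have hmem : p ∈ {p : Fin 3 → ℝ | 1 ≤ p 0} := h1
      rw [Set.indicator_of_mem hmem, Pi.one_apply]
      exact one_le_pow₀ h1
    · have hmem : p ∉ {p : Fin 3 → ℝ | 1 ≤ p 0} := h1
      rw [Set.indicator_of_notMem hmem]
      exact pow_nonneg hp.1 n

/-- The RP-interpolation integrand `p ↦ λ^t cos(k·z)` is measurable. -/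
theorem measurable_rpInterpolationIntegrand (t : ℝ) (z : Fin 2 → ℤ) :
    Measurable fun p : Fin 3 → ℝ => (p 0) ^ t * Real.cos (∑ j : Fin 2, p j.succ * (z j : ℝ)) := by
  refine ((measurable_pi_apply 0).pow_const t).mul (Real.measurable_cos.comp ?_)
  exact Finset.measurable_sum _ fun j _ => (measurable_pi_apply _).mul_const _

end CriticalTwoPointGSMJs.NoAtomOne

open CriticalTwoPointGSMJs.JsNoAtom CriticalTwoPointGSMJs.NoAtomOne in
/-- **Stub `js_noAtomOne` (no spectral mass at `λ = 1`), line `Sketch` (canonical-lift spine) of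
crux `CriticalTwoPointGSM`.** Every joint spectral measure `ρ` of the critical two-point function of
the nearest-neighbour Ising model on `ℤ³` — a probability measure on `ℝ³` carried by
`[0,1]×[-π,π]²` with `⟨σ₀σ_{(n,z)}⟩⁺_{β_c} = ∫ λ^{|n|} cos(k·z) dρ` — gives no mass to `{1 ≤ λ}`:
`ρ{1 ≤ λ} ≤ ∫ λⁿ dρ = ⟨σ₀σ_{n e₀}⟩⁺_{β_c} → 0` (no long-range order at `β_c`, via the infrared
upper bound behind `criticalTwoPoint_tendsto_zero_cofinite`). -/
theorem js_noAtomOne : ∀ ρ : Measure (Fin 3 → ℝ), IsProbabilityMeasure ρ →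
    ρ {p | 0 ≤ p 0 ∧ p 0 ≤ 1 ∧ ∀ j : Fin 2, -Real.pi ≤ p j.succ ∧ p j.succ ≤ Real.pi}ᶜ = 0 →
    (∀ (n : ℤ) (z : Fin 2 → ℤ), criticalTwoPoint 3 (Fin.cons n z) =
      ∫ p, (p 0) ^ n.natAbs * Real.cos (∑ j : Fin 2, p j.succ * (z j : ℝ)) ∂ρ) →
    ρ {p | 1 ≤ p 0} = 0 := by
  intro ρ hρ hsupp hrep
  -- `ρ{1 ≤ λ} ≤ G(n e₀)` for every `n`
  have hle : ∀ n : ℕ, ρ.real {p | 1 ≤ p 0} ≤ criticalTwoPoint 3 (Pi.single (0 : Fin 3) (n : ℤ)) :=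
    fun n => (measureReal_one_le_le_axisMoment ρ hsupp n).trans_eq (axisMoment_eq ρ hrep n)
  -- and `G(n e₀) → 0` (`criticalTwoPoint_tendsto_zero_cofinite` along the axis sequence `n e₀`)
  have hlim : Tendsto (fun n : ℕ => criticalTwoPoint 3 (Pi.single (0 : Fin 3) (n : ℤ))) atTop (𝓝 0) :=
    criticalTwoPoint_tendsto_zero_cofinite.comp tendsto_natCast_single_axis_cofinite
  have h0 : ρ.real {p | 1 ≤ p 0} ≤ 0 := ge_of_tendsto' hlim hle
  have hz : ρ.real {p | 1 ≤ p 0} = 0 := le_antisymm h0 measureReal_nonneg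
  exact (measureReal_eq_zero_iff (measure_ne_top ρ _)).1 hz

open CriticalTwoPointGSMJs.NoAtomOne in
/-- **Stub `rpInterpolation_tendsto_zero` (the RP interpolation vanishes at infinity), line `Sketch`
(canonical-lift spine) of crux `CriticalTwoPointGSM`.** For a probability measure `ρ` on `ℝ³`
carried by `[0,1]×[-π,π]²` with no mass on `{1 ≤ λ}`, the reflection-positive interpolation
`F(t, z) = ∫ λ^t cos(k·z) dρ` tends to `0` as `t → ∞`, for every transverse `z ∈ ℤ²`: a.e.
`0 ≤ λ < 1`, so `λ^t → 0`, dominated by `1`. -/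
theorem rpInterpolation_tendsto_zero : ∀ ρ : Measure (Fin 3 → ℝ), IsProbabilityMeasure ρ →
    ρ {p | 0 ≤ p 0 ∧ p 0 ≤ 1 ∧ ∀ j : Fin 2, -Real.pi ≤ p j.succ ∧ p j.succ ≤ Real.pi}ᶜ = 0 →
    ρ {p | 1 ≤ p 0} = 0 →
    ∀ z : Fin 2 → ℤ, Tendsto (fun t : ℝ =>
      ∫ p, (p 0) ^ t * Real.cos (∑ j : Fin 2, p j.succ * (z j : ℝ)) ∂ρ) atTop (𝓝 0) := by
  intro ρ hρ hsupp hone z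
  have hae := ae_mem_Ico_of_box ρ hsupp hone
  have h := tendsto_integral_filter_of_dominated_convergence (μ := ρ) (l := atTop)
    (F := fun (t : ℝ) (p : Fin 3 → ℝ) => (p 0) ^ t * Real.cos (∑ j : Fin 2, p j.succ * (z j : ℝ)))
    (f := fun _ => (0 : ℝ)) (fun _ => (1 : ℝ))
    (Eventually.of_forall fun t => (measurable_rpInterpolationIntegrand t z).aestronglyMeasurable)
    ?_ (integrable_const 1) ?_
  · rwa [integral_zero] at h
  · -- domination by `1` for `t ≥ 0`
    filter_upwards [eventually_ge_atTop (0 : ℝ)] with t ht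
    filter_upwards [hae] with p hp
    rw [norm_mul, Real.norm_eq_abs, Real.norm_eq_abs, abs_of_nonneg (Real.rpow_nonneg hp.1 t)]
    exact mul_le_one₀ (Real.rpow_le_one hp.1 hp.2.le ht) (abs_nonneg _) (Real.abs_cos_le_one _)
  · -- pointwise a.e. convergence `λ^t cos(k·z) → 0`
    filter_upwards [hae] with p hp
    have h0 : Tendsto (fun t : ℝ => (p 0) ^ t) atTop (𝓝 0) :=
      tendsto_rpow_atTop_of_base_lt_one (p 0) (by linarith [hp.1]) hp.2
    simpa only [zero_mul] using h0.mul_const (Real.cos (∑ j : Fin 2, p j.succ * (z j : ℝ)))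

end

end Summit.CriticalPhenomena.Ising3DConformalLimit.Theorems
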